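import Summits.AtomisticToContinuum.Crystallization.Theses.PRVarianceCertificate
import Summits.AtomisticToContinuum.Crystallization.Theorems.PRVarianceCertificateGroundStateVarianceCertificateAttainment
import Summits.AtomisticToContinuum.Crystallization.Theorems.PRVarianceCertificateCoerciveToDefectVanish

/-!
# `CoerciveVarianceCertificate` (stmt-AtomisticToContinuum-11860): what the crux implies BY NAME

Helper file of route `PRVarianceCertificate`, crux `CoerciveVarianceCertificate` (rank 3, = X of the
thesis): `∃ P C, 0 < C ∧ e_LJ(P) ≤ -C/24 ∧ ∀ R ε > 0 ∃ c > 0, ∀ LJ ground states x (N ≥ 2),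
c · #{(R, ε)-unmatched sites} ≤ C · Σ_i t_i(x) - Σ_i s_i(x)²`.  Nothing here closes the crux.  It
records, kernel-checked, the NECESSITY chain that sizes every line for it:

* `sum_sq_le_of_coercive`, `groundStateVarianceCertificate_of_coerciveVarianceCertificate` — dropping
  the defect count (`0 ≤ c · #`) gives crux 11859 `GroundStateVarianceCertificate` with the same
  witness `(P, C)`;
* `coerciveWitness_rigid` — hence (by `certificateWitness_rigid` of the 11859 line) every witness has
  `e(P) = min_Q e(Q)`, `C = -24 · e(P)` and `E(N)/N → e(P)`: the constant carries no slack and the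
  template must be a periodic Lennard-Jones minimiser of `ℝ³`;
* `crysPeriodicMinAttained_of_coerciveVarianceCertificate` — so the crux implies the shared item
  0627 `CrysPeriodicMinAttained` (attainment of the periodic minimum, "completely open in dimension
  three", Blanc–Lewin 2015 §2.3);
* `bulkDefectVanish_of_coerciveVarianceCertificate` — and the shared hinge 0751 `BulkDefectVanish`
  (the landed glue `coerciveToDefectVanish_proof` fed with the landed supports);
* `crystallization_of_coerciveVarianceCertificate` — and therefore the whole sub-problem statement
  `_root_.Crystallization` (both conjuncts), by the route's deciding theorem `closes` with every
  other hypothesis discharged from the tree.  In words: any proof of this one crux is a proof of the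
  crystallization conjecture for Lennard-Jones in `ℝ³`; no line can isolate a cheaper kernel.

All statements are `[folklore]` bookkeeping (Blanc–Lewin 2015, §§1.1–2.3).
-/

noncomputable section

namespace Summit.AtomisticToContinuum.Crystallization.Theorems.PRVarianceCertificate.CoerciveVarianceCertificate

open scoped BigOperators
open Filter Topology
open Literature.MathematicalPhysics.StatisticalMechanics
open Summit.AtomisticToContinuum.Crystallization.Theses.PRVarianceCertificate

/-- **Dropping the defect count.** For a fixed witness `(P, C)` of the coercive clause, every
Lennard-Jones ground state satisfies `Σ s² ≤ C Σ t`: at `R = ε = 1` the defect term `c · #` is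
non-negative (`N ≥ 2`), and for `N ≤ 1` both sides vanish (empty neighbour sums). [folklore] -/
theorem sum_sq_le_of_coercive {P : PeriodicConfiguration 3} {C : ℝ}
    (hcoer : ∀ R ε : ℝ, 0 < R → 0 < ε → ∃ c : ℝ, 0 < c ∧
      ∀ (N : ℕ) (x : Fin N → EuclideanSpace ℝ (Fin 3)), IsGroundState lennardJones x → 2 ≤ N →
        c * (Nat.card {i : Fin N // ¬ ∃ A : EuclideanSpace ℝ (Fin 3) →ₗᵢ[ℝ]
          EuclideanSpace ℝ (Fin 3), (∀ p ∈ P.points, ‖p‖ ≤ R → ∃ j : Fin N,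
            dist (x j) (x i + A p) ≤ ε) ∧ (∀ j : Fin N, dist (x j) (x i) ≤ R →
              ∃ p ∈ P.points, dist (x j) (x i + A p) ≤ ε)} : ℝ) ≤
          C * ∑ i, siteEnergy (fun r => (r⁻¹) ^ 12) x i -
            ∑ i, (siteEnergy (fun r => (r⁻¹) ^ 6) x i) ^ 2)
    {N : ℕ} {x : Fin N → EuclideanSpace ℝ (Fin 3)} (hx : IsGroundState lennardJones x) :
    ∑ i, (siteEnergy (fun r => (r⁻¹) ^ 6) x i) ^ 2 ≤ C * ∑ i, siteEnergy (fun r => (r⁻¹) ^ 12) x i := by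
  obtain ⟨c, hc, hcN⟩ := hcoer 1 1 one_pos one_pos
  rcases Nat.lt_or_ge N 2 with hN | hN
  · -- `N ≤ 1`: every site sum is empty
    have hsub : Subsingleton (Fin N) := by
      rcases Nat.le_one_iff_eq_zero_or_eq_one.1 (Nat.lt_succ_iff.1 hN) with rfl | rfl <;>
        infer_instance
    have hs : ∀ (V : ℝ → ℝ) (i : Fin N), siteEnergy V x i = 0 := fun V i => by
      unfold siteEnergy
      refine Finset.sum_eq_zero fun k hk => ?_
      exact absurd (Subsingleton.elim k i) (Finset.ne_of_mem_erase hk)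
    simp [hs]
  · have h1 := hcN N x hx hN
    have h0 : (0 : ℝ) ≤ c * (Nat.card {i : Fin N // ¬ ∃ A : EuclideanSpace ℝ (Fin 3) →ₗᵢ[ℝ]
        EuclideanSpace ℝ (Fin 3), (∀ p ∈ P.points, ‖p‖ ≤ 1 → ∃ j : Fin N,
          dist (x j) (x i + A p) ≤ 1) ∧ (∀ j : Fin N, dist (x j) (x i) ≤ 1 →
            ∃ p ∈ P.points, dist (x j) (x i + A p) ≤ 1)} : ℝ) :=
      mul_nonneg hc.le (Nat.cast_nonneg _)
    linarith

/-- **The coercive crux contains crux 11859.** A witness `(P, C)` of `CoerciveVarianceCertificate`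
is a witness of `GroundStateVarianceCertificate` (`sum_sq_le_of_coercive`). [folklore] -/
theorem groundStateVarianceCertificate_of_coerciveVarianceCertificate :
    CoerciveVarianceCertificate → GroundStateVarianceCertificate :=
  fun ⟨P, C, hC, heP, hcoer⟩ => ⟨P, C, hC, heP, fun _ _ hx => sum_sq_le_of_coercive hcoer hx⟩

/-- **Sharp-constant normal form of a coercive witness.** If `(P, C)` witnesses
`CoerciveVarianceCertificate` then `P` minimises the Lennard-Jones energy per particle over periodic
configurations of `ℝ³`, `C = -24 · e_LJ(P)`, and `E(N)/N → e_LJ(P)` (`certificateWitness_rigid` of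
the 11859 line applied to the contained 11859 witness). [folklore] -/
theorem coerciveWitness_rigid {P : PeriodicConfiguration 3} {C : ℝ} (hC : 0 < C)
    (heP : P.energyPerParticle lennardJones ≤ -(C / 24))
    (hcoer : ∀ R ε : ℝ, 0 < R → 0 < ε → ∃ c : ℝ, 0 < c ∧
      ∀ (N : ℕ) (x : Fin N → EuclideanSpace ℝ (Fin 3)), IsGroundState lennardJones x → 2 ≤ N →
        c * (Nat.card {i : Fin N // ¬ ∃ A : EuclideanSpace ℝ (Fin 3) →ₗᵢ[ℝ]
          EuclideanSpace ℝ (Fin 3), (∀ p ∈ P.points, ‖p‖ ≤ R → ∃ j : Fin N,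
            dist (x j) (x i + A p) ≤ ε) ∧ (∀ j : Fin N, dist (x j) (x i) ≤ R →
              ∃ p ∈ P.points, dist (x j) (x i + A p) ≤ ε)} : ℝ) ≤
          C * ∑ i, siteEnergy (fun r => (r⁻¹) ^ 12) x i -
            ∑ i, (siteEnergy (fun r => (r⁻¹) ^ 6) x i) ^ 2) :
    (∀ Q : PeriodicConfiguration 3,
        P.energyPerParticle lennardJones ≤ Q.energyPerParticle lennardJones) ∧
      C = -24 * P.energyPerParticle lennardJones ∧
      Tendsto (fun N : ℕ => groundStateEnergy lennardJones 3 N / N) atTop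
        (𝓝 (P.energyPerParticle lennardJones)) :=
  GroundStateVarianceCertificateLine.certificateWitness_rigid hC.le heP
    fun _ _ hx => sum_sq_le_of_coercive hcoer hx

/-- **The coercive crux implies item 0627** `CrysPeriodicMinAttained` (attainment of the periodic
Lennard-Jones minimum in `ℝ³`; Blanc–Lewin 2015 §2.3: open), through crux 11859 and the landed edge
`crysPeriodicMinAttained_of_groundStateVarianceCertificate`. [folklore] -/
theorem crysPeriodicMinAttained_of_coerciveVarianceCertificate : CoerciveVarianceCertificate →
    Summit.AtomisticToContinuum.Crystallization.Theses.CrystalLocalRigidity.CrysPeriodicMinAttained :=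
  fun h => GroundStateVarianceCertificateLine.crysPeriodicMinAttained_of_groundStateVarianceCertificate
    (groundStateVarianceCertificate_of_coerciveVarianceCertificate h)

/-- **The coercive crux implies the hinge 0751** `BulkDefectVanish`: the landed glue
`coerciveToDefectVanish_proof` (item 11866) with its two supports discharged from the tree
(`crysEnergyUpper_proof`, item 11865; `CrysPeriodicBddBelow_holds`, item 0714). [folklore] -/
theorem bulkDefectVanish_of_coerciveVarianceCertificate : CoerciveVarianceCertificate →
    BulkDefectVanish :=
  fun h => Summit.AtomisticToContinuum.Crystallization.Theorems.coerciveToDefectVanish_proof h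
    Summit.AtomisticToContinuum.Crystallization.Theorems.crysEnergyUpper_proof
    CrysPeriodicBddBelow_holds

/-- **The coercive crux alone implies the sub-problem statement** `Crystallization`
(`HasPeriodicGroundStateEnergy lennardJones 3 ∧ IsCrystallizing lennardJones 3`): the route's
deciding theorem `closes` with `GroundStateVarianceCertificate` supplied by the containment above and
every support discharged from the tree (`certificateBoundsEnergy_proof` 11864, `crysEnergyUpper_proof`
11865, `CrysPeriodicBddBelow_holds` 0714, `coerciveToDefectVanish_proof` 11866,
`defectVanishCrystallizes_proof` 0752).  So a proof of this crux is a proof of the crystallization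
conjecture for Lennard-Jones in `ℝ³`. [folklore] -/
theorem crystallization_of_coerciveVarianceCertificate : Summit.AtomisticToContinuum.Crystallization.Theses.PRVarianceCertificate.CoerciveVarianceCertificate → _root_.Crystallization :=
  fun h => closes (groundStateVarianceCertificate_of_coerciveVarianceCertificate h) h
    Summit.AtomisticToContinuum.Crystallization.Theorems.certificateBoundsEnergy_proof
    Summit.AtomisticToContinuum.Crystallization.Theorems.crysEnergyUpper_proof
    CrysPeriodicBddBelow_holds
    Summit.AtomisticToContinuum.Crystallization.Theorems.coerciveToDefectVanish_proof
    Summit.AtomisticToContinuum.Crystallization.Theorems.ThreeConeCertificateDefectVanishCrystallizes.defectVanishCrystallizes_proof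

end Summit.AtomisticToContinuum.Crystallization.Theorems.PRVarianceCertificate.CoerciveVarianceCertificate

end
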